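/-
Copyright (c) 2026 the pub-hodgecm-mathlib formalisation cell (harness21).  Prover seat hodgecm-mathlib-K2E4-p23 (g0) (E4 base on loan to ENGINE E1), Track B ∕ K2-LIT,
h413 = `stmt-HodgeConjecture-24833`, campaign «EIS-WHITTAKER-3» (`U(2,1)`, CM `L ∕ L⁺`), block D-W2 · W2₃-arch, FILE A (dealer K2E1-plan (g5) 2026-09-04T08:13:29Z;
CONVENTIONS W0₃ 2fdd2f7063acaab9 §4 (v)): THE ARCHIMEDEAN WHITTAKER FACTOR AT A COMPLEX PLACE — `W_w(ξ,z) = 2π²·4^{1−z}·|δ|_w⁻¹·Γ(z)⁻²·𝓜[e^{−t−8π²|ξ|²∕t}](2z−2)`.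
-/
import Summits.HodgeConjecture.HodgeConjecture.Theorems.K2E1ArchWhittakerContinuation     -- ★ p858148 (N = 2 real-place twin): `onePlusSqPow_mul_Gamma_eq_integral` :58 (Hecke's Gamma trick)
import Summits.HodgeConjecture.HodgeConjecture.Theorems.K2E1ArchWhittakerConstantTerm      -- ★ (r1): `integral_onePlusSqPow_eq` (`∫_ℝ (1 + c s²)^{−z} ds = √(π∕c)·Γ(z−½)∕Γ(z)`)
import Mathlib.Analysis.SpecialFunctions.Gaussian.FourierTransform                        -- `GaussianFourier.integral_cexp_neg_mul_sq_norm_add`, `…integral_rexp_neg_mul_sq_norm` (inner-product-space Gaussians)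
import HarnessLib

/-!
# K2·E1 — `K2E1ArchWhittakerContinuationU3` («EIS-WHITTAKER-3», W2₃-arch, FILE A): the archimedean Whittaker factor of the spherical Eisenstein series on `U(2,1)` at a COMPLEX place

Track B ∕ K2-LIT, crux h413 = `stmt-HodgeConjecture-24833`, route of record `HCCMUnconditional`; cell `hodgecm-mathlib`, squad K2, ENGINE E1, campaign «EIS-WHITTAKER-3»
(dealer K2E1-plan (g5), DEALS memo fe56b7cd5d935977 §D-W2; formula pinned by K2E1b-plan (g6)'s CONVENTIONS memo W0₃ 2fdd2f7063acaab9 §4 (v), binder style §7).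
Prover seat `hodgecm-mathlib-K2E4-p23` (g0).  THEOREMS ONLY (no `def`, no `instance`, no notation, no named-fact hypothesis, no `sorry`); lane
`--supports stmt-HodgeConjecture-24833 --as helper` (count-neutral).  Closes no socket.  FILE B = `K2E1ArchWhittakerDecayUniformU3` (continuation in `z`, strip bound,
local uniform decay `e^{−2√2π|ξ|}`, products over the complex places).

THE MATHEMATICS [Bump1997, §1.6, §3.7; Garrett2018, §1.9–§1.10; MoeglinWaldspurger1995, I.2.10; the `N = 2` real-place twin is ★ p858148].  `L ∕ L⁺` CM, `w` a complex place of `L`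
over the real place `v` of `L⁺`, `|δ|_w = w(δ) > 0` the modulus of the trace-zero parameter `δ` (`cδ = −δ`).  On the big cell the spherical flat section `H^z` restricted to the
line `u(X, tδ)` is, at `w`, the symbol `((1 + ½|X|²)² + |δ|_w² s²)^{−z}` (`X ∈ E_w = ℂ`, `s ∈ L⁺_v = ℝ`; ★ (a2)₃ `K2E1HeightBigCellLineFormulaU3` :325).  The Whittaker layer of
`E − E_B` first averages over the centre (`s`) and then takes the Fourier transform in `X` against Tate's character, which at a complex place is `𝐞(−2 Re(ξX)) = e^{−4πi Re(ξX)}`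
(`mixedTrace = 2 Re` at complex places), `dX` = Lebesgue measure on `ℂ ≅ ℝ²` (Mathlib's `volume` on the real inner-product space `ℂ`, `Complex.volume_preserving_equiv_real_prod`):
* §1 CENTRE: `Ψ_w(X) := ∫_ℝ ((1 + ½|X|²)² + |δ|_w² s²)^{−z} ds = |δ|_w⁻¹·√π·Γ(z−½)Γ(z)⁻¹·(1 + ½|X|²)^{1−2z}` (`Re z > ½`; factor `A^{−z}`, then ★ (r1) at `c = |δ|_w²∕A`).
* §2 GAUSSIAN FIBRE on `ℂ`: `∫_ℂ e^{−(t∕2)|X|²} e^{−4πi Re(ξX)} dX = (2π∕t)·e^{−8π²|ξ|²∕t}` (Mathlib `GaussianFourier.integral_cexp_neg_mul_sq_norm_add` on `V = ℂ`, `⟪conj ξ, X⟫_ℝ = Re(ξX)`,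
  `finrank_ℝ ℂ = 2`).
* §3 GAMMA SUBORDINATION + FUBINI (`Re μ > 1`; absolutely convergent iff so: `∫∫|·| = 2π·Γ(Re μ − 1)`):
  `∫_ℂ (1 + ½|X|²)^{−μ} e^{−4πi Re(ξX)} dX = 2π·Γ(μ)⁻¹·𝓜[t ↦ e^{−t − 8π²|ξ|²∕t}](μ − 1)`.
* §4 THE HEAD (`μ = 2z − 1`, Legendre duplication `Γ(z−½)Γ(z) = Γ(2z−1)·2^{2−2z}·√π`, Mathlib `Complex.Gamma_mul_Gamma_add_half`): for `Re z > 1` (the window of absolute convergence)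
  **`W_w(ξ,z) := ∫_ℂ Ψ_w(X)·e^{−4πi Re(ξX)} dX = 2π²·4^{1−z}·|δ|_w⁻¹·Γ(z)⁻²·𝓜[e^{−t−A∕t}](2z − 2)`, `A = A_w(ξ) := 8π²|ξ|²`** — INDEX `2z − 2`; also stated from the raw symbol
  (iterated `ds dX`).  The right side is entire in `z` for `ξ ≠ 0` (FILE B; kernel letters = ★ p858148 :228–:303).  SANITY (prose, not a theorem): `ξ → 0⁺` gives
  `2π²4^{1−σ}|δ|_w⁻¹Γ(σ)⁻²Γ(2σ−2) = π^{3∕2}|δ|_w⁻¹Γ(σ−½)∕((σ−1)Γ(σ)) = c_w(σ)`, the (q10) archimedean scalar ✓.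
SAT-WITNESS (ruling «VAC-U» (3)): nothing is quantified over a structure; `|δ|_w`, `ξ`, `z` free; §2 at `ξ = 0`, `t = 2`: `∫_ℂ e^{−|X|²} dX = π` ✓.
HONEST LABEL: HC_CM is proved only modulo the 7 printed citations (2 remaining named inputs: hLiu418 = `stmt-HodgeConjecture-24832`, h413 = `stmt-HodgeConjecture-24833`)
until rung 0 closes; this file asserts no named fact and closes no socket.
References: [Bump1997] D. Bump, *Automorphic Forms and Representations* (1997), §1.6 (1.24)–(1.27), §3.7 · [Garrett2018] P. Garrett, *Modern Analysis of Automorphic Forms by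
Example* 1 (2018), §1.9–§1.10 · [MoeglinWaldspurger1995] C. Mœglin, J.-L. Waldspurger, *Spectral Decomposition and Eisenstein Series* (1995), I.2.10.
-/

set_option autoImplicit false
-- the mandated namespace repeats the single-problem summit's segment (`HodgeConjecture.HodgeConjecture`)
set_option linter.dupNamespace false

noncomputable section

open MeasureTheory Filter Topology Set Real
open scoped RealInnerProductSpace
open Summit.HodgeConjecture.HodgeConjecture.Cruxes.H413.K2E1OnePlusSqPowerSymbol (onePlusSq_pos)
open Summit.HodgeConjecture.HodgeConjecture.Cruxes.H413.K2E1ArchWhittakerContinuation (onePlusSqPow_mul_Gamma_eq_integral)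
open Summit.HodgeConjecture.HodgeConjecture.Cruxes.H413.K2E1ArchWhittakerConstantTerm (integral_onePlusSqPow_eq)

namespace Summit.HodgeConjecture.HodgeConjecture.Cruxes.H413.K2E1ArchWhittakerContinuationU3

/-! ## §1  The centre integral at a complex place: `Ψ_w(X)` -/

/-- `∫_ℝ (A + c s²)^{−z} ds = √(π∕c)·Γ(z−½)Γ(z)⁻¹·A^{½−z}` for `A, c > 0`, `Re z > ½` (factor `A^{−z}` out of the positive real base, ★ (r1) at `c∕A`, `A^{−z}·√A = A^{½−z}`).
[cite: Bump1997, §1.6 (1.25)] [cite: Garrett2018, §1.9] -/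
theorem integral_affineSqPow_eq {A c : ℝ} (hA : 0 < A) (hc : 0 < c) {z : ℂ} (hz : 1 / 2 < z.re) :
    ∫ s : ℝ, (((A + c * s ^ 2 : ℝ)) : ℂ) ^ (-z) =
      ((Real.sqrt (π / c) : ℝ) : ℂ) * Complex.Gamma (z - 1 / 2) / Complex.Gamma z * ((A : ℝ) : ℂ) ^ (1 / 2 - z) := by
  have hcA : 0 < c / A := div_pos hc hA
  have hA0 : ((A : ℝ) : ℂ) ≠ 0 := by exact_mod_cast hA.ne'
  have hpt : ∀ s : ℝ, (((A + c * s ^ 2 : ℝ)) : ℂ) ^ (-z) = ((A : ℝ) : ℂ) ^ (-z) * (((1 + c / A * s ^ 2 : ℝ)) : ℂ) ^ (-z) := by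
    intro s
    rw [← Complex.mul_cpow_ofReal_nonneg hA.le (onePlusSq_pos hcA.le s).le, ← Complex.ofReal_mul]
    congr 2
    field_simp
  simp_rw [hpt]
  rw [integral_const_mul, integral_onePlusSqPow_eq hz hcA]
  have hsqrt : Real.sqrt (π / (c / A)) = Real.sqrt (π / c) * Real.sqrt A := by
    rw [show π / (c / A) = π / c * A by field_simp, Real.sqrt_mul (by positivity)]
  have hsqA : ((Real.sqrt A : ℝ) : ℂ) = ((A : ℝ) : ℂ) ^ ((1 / 2 : ℂ)) := by
    rw [Real.sqrt_eq_rpow, Complex.ofReal_cpow hA.le]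
    norm_num
  have hpow : ((A : ℝ) : ℂ) ^ (-z) * ((Real.sqrt A : ℝ) : ℂ) = ((A : ℝ) : ℂ) ^ (1 / 2 - z) := by
    rw [hsqA, ← Complex.cpow_add _ _ hA0]
    congr 1
    ring
  rw [hsqrt, Complex.ofReal_mul, ← hpow]
  ring

/-- `(B²)^w = B^{2w}` for a positive real base (real logarithm). [folklore] -/
theorem ofReal_sq_cpow {B : ℝ} (hB : 0 < B) (w : ℂ) : (((B ^ 2 : ℝ)) : ℂ) ^ w = ((B : ℝ) : ℂ) ^ (2 * w) := by
  have hB0 : ((B : ℝ) : ℂ) ≠ 0 := by exact_mod_cast hB.ne'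
  have hB2 : (((B ^ 2 : ℝ)) : ℂ) ≠ 0 := by exact_mod_cast (pow_pos hB 2).ne'
  rw [Complex.cpow_def_of_ne_zero hB2, Complex.cpow_def_of_ne_zero hB0, ← Complex.ofReal_log (pow_pos hB 2).le, Real.log_pow,
    ← Complex.ofReal_log hB.le]
  push_cast
  ring

/-- **THE CENTRE INTEGRAL AT A COMPLEX PLACE** (`|δ|_w = dδ > 0`, `X ∈ ℂ`, `Re z > ½`):
`Ψ_w(X) = ∫_ℝ ((1 + ½|X|²)² + |δ|_w² s²)^{−z} ds = |δ|_w⁻¹·√π·Γ(z−½)·Γ(z)⁻¹·(1 + ½|X|²)^{1−2z}` — §1 at `A = (1 + ½|X|²)²`, `c = |δ|_w²` (symbol letters of ★ (a2)₃ :325; CONVENTIONS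
W0₃ §4 (v)). [cite: Bump1997, §1.6 (1.25)] [cite: Garrett2018, §1.9] -/
theorem integral_archCentreSymbol_eq {dδ : ℝ} (hδ : 0 < dδ) (X : ℂ) {z : ℂ} (hz : 1 / 2 < z.re) :
    ∫ s : ℝ, ((((1 + ‖X‖ ^ 2 / 2) ^ 2 + dδ ^ 2 * s ^ 2 : ℝ)) : ℂ) ^ (-z) =
      ((Real.sqrt π / dδ : ℝ) : ℂ) * Complex.Gamma (z - 1 / 2) / Complex.Gamma z * (((1 + ‖X‖ ^ 2 / 2 : ℝ)) : ℂ) ^ (1 - 2 * z) := by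
  have hB : 0 < 1 + ‖X‖ ^ 2 / 2 := by positivity
  rw [integral_affineSqPow_eq (pow_pos hB 2) (pow_pos hδ 2) hz, ofReal_sq_cpow hB, show 2 * (1 / 2 - z) = 1 - 2 * z by ring,
    Real.sqrt_div Real.pi_pos.le, Real.sqrt_sq hδ.le]

/-! ## §2  The Gaussian fibre on `E_w = ℂ` with Tate's character `e^{−4πi Re(ξX)}` -/

/-- **THE 2-D GAUSSIAN TRANSFORM** (`t > 0`, `ξ ∈ ℂ`, Lebesgue `dX` on `ℂ`): `∫_ℂ e^{−(t∕2)|X|²}·e^{−4πi Re(ξX)} dX = (2π∕t)·e^{−8π²|ξ|²∕t}` (Mathlib `integral_cexp_neg_mul_sq_norm_add` on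
the real inner-product space `ℂ`: `b = t∕2`, `c = −4πi`, `w = conj ξ`, `⟪conj ξ, X⟫_ℝ = Re(ξX)`, `finrank_ℝ ℂ = 2`, `c²‖w‖²∕(4b) = −8π²|ξ|²∕t`). [cite: Bump1997, §1.6 (1.26)] -/
theorem integral_cexp_neg_mul_norm_sq_mul_phase {t : ℝ} (ht : 0 < t) (ξ : ℂ) :
    ∫ X : ℂ, Complex.exp (-((t / 2 : ℝ) : ℂ) * ‖X‖ ^ 2) * Complex.exp (-(4 * π * Complex.I * (ξ * X).re)) =
      ((2 * π / t : ℝ) : ℂ) * Complex.exp (-((8 * π ^ 2 * ‖ξ‖ ^ 2 / t : ℝ) : ℂ)) := by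
  have hb : 0 < ((t / 2 : ℝ) : ℂ).re := by rw [Complex.ofReal_re]; positivity
  have key := GaussianFourier.integral_cexp_neg_mul_sq_norm_add hb (-(4 * π * Complex.I)) (starRingEnd ℂ ξ)
  have hinner : ∀ X : ℂ, ⟪starRingEnd ℂ ξ, X⟫ = (ξ * X).re := by
    intro X
    rw [Complex.inner, starRingEnd_self_apply, mul_comm]
  have hpt : ∀ X : ℂ, Complex.exp (-((t / 2 : ℝ) : ℂ) * ‖X‖ ^ 2) * Complex.exp (-(4 * π * Complex.I * (ξ * X).re)) =
      Complex.exp (-((t / 2 : ℝ) : ℂ) * ‖X‖ ^ 2 + -(4 * π * Complex.I) * (⟪starRingEnd ℂ ξ, X⟫ : ℝ)) := by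
    intro X
    rw [← Complex.exp_add, hinner]
    ring_nf
  simp_rw [hpt]
  rw [key]
  have h1 : ((Module.finrank ℝ ℂ : ℂ) / 2) = 1 := by
    rw [Complex.finrank_real_complex]; norm_num
  rw [h1, Complex.cpow_one, Complex.norm_conj]
  have ht0 : (t : ℂ) ≠ 0 := by exact_mod_cast ht.ne'
  congr 1
  · push_cast
    field_simp
  · congr 1
    rw [show (-(4 * ↑π * Complex.I)) ^ 2 = -(16 * (π : ℂ) ^ 2) by rw [neg_sq, mul_pow, Complex.I_sq]; ring]
    push_cast
    field_simp
    ring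

/-! ## §3  Gamma subordination and Fubini on `(0,∞) × ℂ` -/

/-- **GAMMA SUBORDINATION** at the symbol `(1 + ½|X|²)^{−μ}`: `(1 + ½|X|²)^{−μ}·Γ(μ) = ∫_0^∞ t^{μ−1} e^{−(1+½|X|²)t} dt` (`Re μ > 0`; ★ :58 at `c = ½`, `s = |X|`).
[cite: Bump1997, §1.6 (1.24)] -/
theorem onePlusHalfNormSqPow_mul_Gamma_eq_integral {μ : ℂ} (hμ : 0 < μ.re) (X : ℂ) :
    (((1 + ‖X‖ ^ 2 / 2 : ℝ)) : ℂ) ^ (-μ) * Complex.Gamma μ =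
      ∫ t in Ioi (0 : ℝ), (t : ℂ) ^ (μ - 1) * Complex.exp (-(((1 + ‖X‖ ^ 2 / 2 : ℝ) : ℂ) * (t : ℂ))) := by
  have h := onePlusSqPow_mul_Gamma_eq_integral hμ (by norm_num : (0 : ℝ) ≤ 1 / 2) ‖X‖
  rw [show (1 + 1 / 2 * ‖X‖ ^ 2 : ℝ) = 1 + ‖X‖ ^ 2 / 2 by ring] at h
  exact h

/-- The modulus of the subordinated kernel: for `t > 0`, `‖t^{μ−1}·e^{−(1+½|X|²)t}·e^{−4πi Re(ξX)}‖ = t^{Re μ−1}·e^{−t}·e^{−(t∕2)|X|²}`. [folklore] -/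
theorem norm_kernelU3 {t : ℝ} (ht : 0 < t) (μ ξ X : ℂ) :
    ‖(t : ℂ) ^ (μ - 1) * Complex.exp (-(((1 + ‖X‖ ^ 2 / 2 : ℝ) : ℂ) * (t : ℂ))) * Complex.exp (-(4 * π * Complex.I * (ξ * X).re))‖ =
      t ^ (μ.re - 1) * Real.exp (-t) * Real.exp (-(t / 2) * ‖X‖ ^ 2) := by
  rw [norm_mul, norm_mul, Complex.norm_cpow_eq_rpow_re_of_pos ht, Complex.norm_exp, Complex.norm_exp]
  have h1 : (-(((1 + ‖X‖ ^ 2 / 2 : ℝ) : ℂ) * (t : ℂ))).re = -t + -(t / 2) * ‖X‖ ^ 2 := by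
    rw [← Complex.ofReal_mul, ← Complex.ofReal_neg, Complex.ofReal_re]; ring
  have h2 : (-(4 * π * Complex.I * (ξ * X).re : ℂ)).re = 0 := by simp
  rw [h1, h2, Real.exp_zero, mul_one, Real.exp_add, Complex.sub_re, Complex.one_re, mul_assoc]

/-- `finrank_ℝ ℂ ∕ 2 = 1` in the exponent of Mathlib's Gaussian formula on `V = ℂ`. [folklore] -/
theorem finrank_real_complex_div_two : ((Module.finrank ℝ ℂ : ℝ) / 2) = 1 := by
  rw [Complex.finrank_real_complex]; norm_num

/-- **TONELLI FOR THE SUBORDINATED KERNEL** (`Re μ > 1`): `(t, X) ↦ t^{μ−1} e^{−(1+½|X|²)t} e^{−4πi Re(ξX)}` is integrable on `(0,∞) × ℂ`: the `X`-sections are Gaussians with a phase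
(integrable because their integral §2 is non-zero), and `∫_ℂ |·| dX = 2π·t^{Re μ − 2}·e^{−t}` is Euler-integrable on `(0,∞)` exactly when `Re μ − 1 > 0`. [cite: Bump1997, §1.6] -/
theorem integrable_kernelU3 {μ : ℂ} (hμ : 1 < μ.re) (ξ : ℂ) :
    Integrable (fun p : ℝ × ℂ => (p.1 : ℂ) ^ (μ - 1) * Complex.exp (-(((1 + ‖p.2‖ ^ 2 / 2 : ℝ) : ℂ) * (p.1 : ℂ))) *
      Complex.exp (-(4 * π * Complex.I * (ξ * p.2).re))) ((volume.restrict (Ioi (0 : ℝ))).prod volume) := by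
  have hmeas : AEStronglyMeasurable (fun p : ℝ × ℂ => (p.1 : ℂ) ^ (μ - 1) * Complex.exp (-(((1 + ‖p.2‖ ^ 2 / 2 : ℝ) : ℂ) * (p.1 : ℂ))) *
      Complex.exp (-(4 * π * Complex.I * (ξ * p.2).re))) ((volume.restrict (Ioi (0 : ℝ))).prod volume) := by
    refine Measurable.aestronglyMeasurable ?_
    refine ((Complex.measurable_ofReal.comp measurable_fst).pow_const _).mul ?_ |>.mul ?_
    · exact Complex.measurable_exp.comp (by fun_prop : Continuous fun p : ℝ × ℂ => -(((1 + ‖p.2‖ ^ 2 / 2 : ℝ) : ℂ) * (p.1 : ℂ))).measurable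
    · exact Complex.measurable_exp.comp (by fun_prop : Continuous fun p : ℝ × ℂ => -(4 * π * Complex.I * ((ξ * p.2).re : ℂ))).measurable
  -- the pointwise splitting `e^{−(1+½|X|²)t} = e^{−t}·e^{−(t/2)|X|²}`
  have hpt : ∀ (t : ℝ) (X : ℂ), (t : ℂ) ^ (μ - 1) * Complex.exp (-(((1 + ‖X‖ ^ 2 / 2 : ℝ) : ℂ) * (t : ℂ))) * Complex.exp (-(4 * π * Complex.I * (ξ * X).re)) =
      (t : ℂ) ^ (μ - 1) * Complex.exp (-(t : ℂ)) * (Complex.exp (-((t / 2 : ℝ) : ℂ) * ‖X‖ ^ 2) * Complex.exp (-(4 * π * Complex.I * (ξ * X).re))) := by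
    intro t X
    rw [show -(((1 + ‖X‖ ^ 2 / 2 : ℝ) : ℂ) * (t : ℂ)) = -(t : ℂ) + -((t / 2 : ℝ) : ℂ) * ‖X‖ ^ 2 by push_cast; ring, Complex.exp_add]
    ring
  refine (integrable_prod_iff hmeas).2 ⟨?_, ?_⟩
  · -- the `X`-sections are Gaussians with a phase
    refine (ae_restrict_mem measurableSet_Ioi).mono fun t (ht : 0 < t) => ?_
    simp only
    simp_rw [hpt t]
    refine Integrable.const_mul (Integrable.of_integral_ne_zero ?_) _
    rw [integral_cexp_neg_mul_norm_sq_mul_phase ht ξ]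
    exact mul_ne_zero (by exact_mod_cast (by positivity : 2 * π / t ≠ 0)) (Complex.exp_ne_zero _)
  · -- `t ↦ ∫_ℂ |·| dX = 2π · t^{Re μ − 2} e^{−t}` is integrable on `(0,∞)`
    have hG : IntegrableOn (fun t : ℝ => 2 * π * (Real.exp (-t) * t ^ ((μ.re - 1) - 1))) (Ioi 0) :=
      (Real.GammaIntegral_convergent (by linarith : 0 < μ.re - 1)).const_mul _
    refine hG.congr_fun (fun t (ht : 0 < t) => ?_) measurableSet_Ioi
    simp only
    simp_rw [norm_kernelU3 ht]
    rw [integral_const_mul, GaussianFourier.integral_rexp_neg_mul_sq_norm (by positivity : (0 : ℝ) < t / 2), finrank_real_complex_div_two, Real.rpow_one,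
      Real.rpow_sub_one ht.ne' (μ.re - 1)]
    field_simp

/-- **THE `X`-INTEGRAL** (`Re μ > 1`, `ξ ∈ ℂ`): `∫_ℂ (1 + ½|X|²)^{−μ} e^{−4πi Re(ξX)} dX = Γ(μ)⁻¹·2π·∫_0^∞ t^{μ−2} e^{−t − 8π²|ξ|²∕t} dt` — subordination (§3), Gaussian fibre (§2), Fubini.
[cite: Bump1997, §1.6 (1.26)–(1.27)] [cite: Garrett2018, §1.10] -/
theorem integral_onePlusHalfNormSqPow_mul_phase_eq {μ : ℂ} (hμ : 1 < μ.re) (ξ : ℂ) :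
    ∫ X : ℂ, (((1 + ‖X‖ ^ 2 / 2 : ℝ)) : ℂ) ^ (-μ) * Complex.exp (-(4 * π * Complex.I * (ξ * X).re)) =
      (Complex.Gamma μ)⁻¹ * ((2 * π : ℝ) : ℂ) *
        ∫ t in Ioi (0 : ℝ), (t : ℂ) ^ (μ - 2) * Complex.exp (-(t : ℂ) - ((8 * π ^ 2 * ‖ξ‖ ^ 2 : ℝ) : ℂ) / (t : ℂ)) := by
  have hμ0 : 0 < μ.re := by linarith
  have hΓ : Complex.Gamma μ ≠ 0 := Complex.Gamma_ne_zero_of_re_pos hμ0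
  have hint := integrable_kernelU3 hμ ξ
  have h1 := integral_prod_symm _ hint
  have h2 := integral_prod _ hint
  -- inner `t`-integral: subordination
  have hinner_t : ∀ X : ℂ, ∫ t in Ioi (0 : ℝ), (t : ℂ) ^ (μ - 1) * Complex.exp (-(((1 + ‖X‖ ^ 2 / 2 : ℝ) : ℂ) * (t : ℂ))) *
      Complex.exp (-(4 * π * Complex.I * (ξ * X).re)) =
      Complex.Gamma μ * ((((1 + ‖X‖ ^ 2 / 2 : ℝ)) : ℂ) ^ (-μ) * Complex.exp (-(4 * π * Complex.I * (ξ * X).re))) := by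
    intro X
    rw [integral_mul_const, ← onePlusHalfNormSqPow_mul_Gamma_eq_integral hμ0 X]
    ring
  -- inner `X`-integral: the Gaussian fibre
  have hinner_X : ∀ t : ℝ, 0 < t → ∫ X : ℂ, (t : ℂ) ^ (μ - 1) * Complex.exp (-(((1 + ‖X‖ ^ 2 / 2 : ℝ) : ℂ) * (t : ℂ))) *
      Complex.exp (-(4 * π * Complex.I * (ξ * X).re)) =
      ((2 * π : ℝ) : ℂ) * ((t : ℂ) ^ (μ - 2) * Complex.exp (-(t : ℂ) - ((8 * π ^ 2 * ‖ξ‖ ^ 2 : ℝ) : ℂ) / (t : ℂ))) := by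
    intro t ht
    have hpt : ∀ X : ℂ, (t : ℂ) ^ (μ - 1) * Complex.exp (-(((1 + ‖X‖ ^ 2 / 2 : ℝ) : ℂ) * (t : ℂ))) * Complex.exp (-(4 * π * Complex.I * (ξ * X).re)) =
        (t : ℂ) ^ (μ - 1) * Complex.exp (-(t : ℂ)) * (Complex.exp (-((t / 2 : ℝ) : ℂ) * ‖X‖ ^ 2) * Complex.exp (-(4 * π * Complex.I * (ξ * X).re))) := by
      intro X
      rw [show -(((1 + ‖X‖ ^ 2 / 2 : ℝ) : ℂ) * (t : ℂ)) = -(t : ℂ) + -((t / 2 : ℝ) : ℂ) * ‖X‖ ^ 2 by push_cast; ring, Complex.exp_add]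
      ring
    simp_rw [hpt]
    rw [integral_const_mul, integral_cexp_neg_mul_norm_sq_mul_phase ht ξ]
    have ht0 : (t : ℂ) ≠ 0 := by exact_mod_cast ht.ne'
    have hpow : (t : ℂ) ^ (μ - 1) * (t : ℂ)⁻¹ = (t : ℂ) ^ (μ - 2) := by
      rw [show μ - 2 = (μ - 1) - 1 by ring, Complex.cpow_sub (μ - 1) 1 ht0, Complex.cpow_one, div_eq_mul_inv]
    have hexp : Complex.exp (-(t : ℂ)) * Complex.exp (-((8 * π ^ 2 * ‖ξ‖ ^ 2 / t : ℝ) : ℂ)) =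
        Complex.exp (-(t : ℂ) - ((8 * π ^ 2 * ‖ξ‖ ^ 2 : ℝ) : ℂ) / (t : ℂ)) := by
      rw [← Complex.exp_add]
      congr 1
      push_cast
      ring
    have hc : ((2 * π / t : ℝ) : ℂ) = ((2 * π : ℝ) : ℂ) * (t : ℂ)⁻¹ := by
      push_cast
      field_simp
    calc (t : ℂ) ^ (μ - 1) * Complex.exp (-(t : ℂ)) * (((2 * π / t : ℝ) : ℂ) * Complex.exp (-((8 * π ^ 2 * ‖ξ‖ ^ 2 / t : ℝ) : ℂ)))
        = ((2 * π : ℝ) : ℂ) * (((t : ℂ) ^ (μ - 1) * (t : ℂ)⁻¹) * (Complex.exp (-(t : ℂ)) * Complex.exp (-((8 * π ^ 2 * ‖ξ‖ ^ 2 / t : ℝ) : ℂ)))) := by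
          rw [hc]; ring
      _ = _ := by rw [hpow, hexp]
  -- assemble
  have hL : ∫ X : ℂ, ∫ t in Ioi (0 : ℝ), (t : ℂ) ^ (μ - 1) * Complex.exp (-(((1 + ‖X‖ ^ 2 / 2 : ℝ) : ℂ) * (t : ℂ))) *
      Complex.exp (-(4 * π * Complex.I * (ξ * X).re)) =
      Complex.Gamma μ * ∫ X : ℂ, (((1 + ‖X‖ ^ 2 / 2 : ℝ)) : ℂ) ^ (-μ) * Complex.exp (-(4 * π * Complex.I * (ξ * X).re)) := by
    simp_rw [hinner_t]
    exact integral_const_mul _ _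
  have hR : ∫ t in Ioi (0 : ℝ), ∫ X : ℂ, (t : ℂ) ^ (μ - 1) * Complex.exp (-(((1 + ‖X‖ ^ 2 / 2 : ℝ) : ℂ) * (t : ℂ))) *
      Complex.exp (-(4 * π * Complex.I * (ξ * X).re)) =
      ((2 * π : ℝ) : ℂ) * ∫ t in Ioi (0 : ℝ), (t : ℂ) ^ (μ - 2) * Complex.exp (-(t : ℂ) - ((8 * π ^ 2 * ‖ξ‖ ^ 2 : ℝ) : ℂ) / (t : ℂ)) := by
    rw [← integral_const_mul]
    exact setIntegral_congr_fun measurableSet_Ioi fun t ht => hinner_X t ht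
  have key : Complex.Gamma μ * ∫ X : ℂ, (((1 + ‖X‖ ^ 2 / 2 : ℝ)) : ℂ) ^ (-μ) * Complex.exp (-(4 * π * Complex.I * (ξ * X).re)) =
      ((2 * π : ℝ) : ℂ) * ∫ t in Ioi (0 : ℝ), (t : ℂ) ^ (μ - 2) * Complex.exp (-(t : ℂ) - ((8 * π ^ 2 * ‖ξ‖ ^ 2 : ℝ) : ℂ) / (t : ℂ)) := by
    rw [← hL, ← h1, h2, hR]
  set LHS := ∫ X : ℂ, (((1 + ‖X‖ ^ 2 / 2 : ℝ)) : ℂ) ^ (-μ) * Complex.exp (-(4 * π * Complex.I * (ξ * X).re)) with hLHS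
  set V := ∫ t in Ioi (0 : ℝ), (t : ℂ) ^ (μ - 2) * Complex.exp (-(t : ℂ) - ((8 * π ^ 2 * ‖ξ‖ ^ 2 : ℝ) : ℂ) / (t : ℂ)) with hV
  calc LHS = (Complex.Gamma μ)⁻¹ * (Complex.Gamma μ * LHS) := by rw [← mul_assoc, inv_mul_cancel₀ hΓ, one_mul]
    _ = (Complex.Gamma μ)⁻¹ * (((2 * π : ℝ) : ℂ) * V) := by rw [key]
    _ = (Complex.Gamma μ)⁻¹ * ((2 * π : ℝ) : ℂ) * V := (mul_assoc _ _ _).symm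

/-- §3 in Mellin currency: `∫_ℂ (1 + ½|X|²)^{−μ} e^{−4πi Re(ξX)} dX = Γ(μ)⁻¹·2π·𝓜[t ↦ e^{−t−A∕t}](μ − 1)`, `A = 8π²|ξ|²` (`Re μ > 1`). [cite: Bump1997, §1.6 (1.27)] -/
theorem integral_onePlusHalfNormSqPow_mul_phase_eq_mellin {μ : ℂ} (hμ : 1 < μ.re) (ξ : ℂ) :
    ∫ X : ℂ, (((1 + ‖X‖ ^ 2 / 2 : ℝ)) : ℂ) ^ (-μ) * Complex.exp (-(4 * π * Complex.I * (ξ * X).re)) =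
      (Complex.Gamma μ)⁻¹ * ((2 * π : ℝ) : ℂ) *
        mellin (fun t : ℝ => Complex.exp (-(t : ℂ) - ((8 * π ^ 2 * ‖ξ‖ ^ 2 : ℝ) : ℂ) / (t : ℂ))) (μ - 1) := by
  rw [integral_onePlusHalfNormSqPow_mul_phase_eq hμ ξ, mellin]
  congr 1
  refine setIntegral_congr_fun measurableSet_Ioi fun t _ => ?_
  rw [smul_eq_mul, show μ - 1 - 1 = μ - 2 by ring]

/-! ## §4  The head: `W_w(ξ,z) = 2π²·4^{1−z}·|δ|_w⁻¹·Γ(z)⁻²·𝓜[e^{−t−8π²|ξ|²∕t}](2z−2)` -/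

/-- `4^{1−z} = 2^{2−2z}`. [folklore] -/
theorem four_cpow_one_sub (z : ℂ) : (4 : ℂ) ^ (1 - z) = (2 : ℂ) ^ (2 - 2 * z) := by
  have h := Complex.mul_cpow_ofReal_nonneg (zero_le_two : (0 : ℝ) ≤ 2) (zero_le_two : (0 : ℝ) ≤ 2) (1 - z)
  push_cast at h
  rw [show (2 : ℂ) * 2 = 4 by norm_num] at h
  rw [h, show (2 : ℂ) - 2 * z = 2 * (1 - z) by ring, Complex.cpow_ofNat_mul, sq]

/-- **THE ARCHIMEDEAN WHITTAKER FACTOR AT A COMPLEX PLACE** (CONVENTIONS W0₃ §4 (v); `|δ|_w = dδ > 0`, `ξ ∈ ℂ`, `Re z > 1` = the window of absolute convergence of `dX`):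
`W_w(ξ,z) := ∫_ℂ Ψ_w(X)·e^{−4πi Re(ξX)} dX = 2π²·4^{1−z}·|δ|_w⁻¹·Γ(z)⁻²·𝓜[t ↦ e^{−t − 8π²|ξ|²∕t}](2z − 2)`, `Ψ_w(X) = |δ|_w⁻¹√π·Γ(z−½)Γ(z)⁻¹·(1 + ½|X|²)^{1−2z}` (§1) —
§3 at `μ = 2z − 1` and Legendre's duplication `Γ(z−½)Γ(z) = Γ(2z−1)·2^{2−2z}·√π` (Mathlib `Complex.Gamma_mul_Gamma_add_half`).  INDEX `2z − 2`, `A_w(ξ) = 8π²|ξ|²`.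
[cite: Bump1997, §1.6 (1.26)–(1.27), §3.7] [cite: Garrett2018, §1.10] [cite: MoeglinWaldspurger1995, I.2.10] -/
theorem integral_archWhittakerU3_eq (dδ : ℝ) (ξ : ℂ) {z : ℂ} (hz : 1 < z.re) :
    ∫ X : ℂ, ((Real.sqrt π / dδ : ℝ) : ℂ) * Complex.Gamma (z - 1 / 2) / Complex.Gamma z * (((1 + ‖X‖ ^ 2 / 2 : ℝ)) : ℂ) ^ (1 - 2 * z) *
        Complex.exp (-(4 * π * Complex.I * (ξ * X).re)) =
      2 * (π : ℂ) ^ 2 * (4 : ℂ) ^ (1 - z) * ((dδ : ℝ) : ℂ)⁻¹ * (Complex.Gamma z)⁻¹ ^ 2 *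
        mellin (fun t : ℝ => Complex.exp (-(t : ℂ) - ((8 * π ^ 2 * ‖ξ‖ ^ 2 : ℝ) : ℂ) / (t : ℂ))) (2 * z - 2) := by
  have hre : (2 * z - 1 : ℂ).re = 2 * z.re - 1 := by simp [Complex.mul_re]
  have hμ : 1 < (2 * z - 1 : ℂ).re := by rw [hre]; linarith
  have hΓz : Complex.Gamma z ≠ 0 := Complex.Gamma_ne_zero_of_re_pos (by linarith)
  have hΓ2 : Complex.Gamma (2 * z - 1) ≠ 0 := Complex.Gamma_ne_zero_of_re_pos (by rw [hre]; linarith)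
  have hpt : ∀ X : ℂ, ((Real.sqrt π / dδ : ℝ) : ℂ) * Complex.Gamma (z - 1 / 2) / Complex.Gamma z * (((1 + ‖X‖ ^ 2 / 2 : ℝ)) : ℂ) ^ (1 - 2 * z) *
      Complex.exp (-(4 * π * Complex.I * (ξ * X).re)) =
      ((Real.sqrt π / dδ : ℝ) : ℂ) * Complex.Gamma (z - 1 / 2) / Complex.Gamma z *
        ((((1 + ‖X‖ ^ 2 / 2 : ℝ)) : ℂ) ^ (-(2 * z - 1)) * Complex.exp (-(4 * π * Complex.I * (ξ * X).re))) := by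
    intro X
    rw [show -(2 * z - 1) = 1 - 2 * z by ring]
    ring
  simp_rw [hpt]
  rw [integral_const_mul, integral_onePlusHalfNormSqPow_mul_phase_eq_mellin hμ ξ, show (2 * z - 1 : ℂ) - 1 = 2 * z - 2 by ring, four_cpow_one_sub]
  -- Legendre duplication at `z − ½`
  have hdup := Complex.Gamma_mul_Gamma_add_half (z - 1 / 2)
  rw [show z - 1 / 2 + 1 / 2 = z by ring, show 2 * (z - 1 / 2) = 2 * z - 1 by ring, show (1 : ℂ) - (2 * z - 1) = 2 - 2 * z by ring] at hdup
  set M := mellin (fun t : ℝ => Complex.exp (-(t : ℂ) - ((8 * π ^ 2 * ‖ξ‖ ^ 2 : ℝ) : ℂ) / (t : ℂ))) (2 * z - 2) with hM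
  set G := Complex.Gamma z with hG
  set G₂ := Complex.Gamma (2 * z - 1) with hG₂
  set P := (2 : ℂ) ^ (2 - 2 * z) with hP
  have hG₁ : Complex.Gamma (z - 1 / 2) = G₂ * P * ((Real.sqrt π : ℝ) : ℂ) / G := eq_div_of_mul_eq hΓz hdup
  rw [hG₁]
  have hsq : ((Real.sqrt π : ℝ) : ℂ) * ((Real.sqrt π : ℝ) : ℂ) = (π : ℂ) := by
    rw [← Complex.ofReal_mul, Real.mul_self_sqrt Real.pi_pos.le]
  have e1 : G₂ * G₂⁻¹ = 1 := mul_inv_cancel₀ hΓ2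
  push_cast
  linear_combination (G₂ * G₂⁻¹ * (2 * (π : ℂ) * P * ((dδ : ℝ) : ℂ)⁻¹ * G⁻¹ ^ 2 * M)) * hsq +
    ((π : ℂ) * (2 * (π : ℂ) * P * ((dδ : ℝ) : ℂ)⁻¹ * G⁻¹ ^ 2 * M)) * e1

/-- **THE SAME FROM THE RAW BIG-CELL SYMBOL** (iterated: centre `ds` first, then `dX`; `Re z > 1`):
`∫_ℂ (∫_ℝ ((1 + ½|X|²)² + |δ|_w² s²)^{−z} ds)·e^{−4πi Re(ξX)} dX = 2π²·4^{1−z}·|δ|_w⁻¹·Γ(z)⁻²·𝓜[e^{−t−8π²|ξ|²∕t}](2z − 2)` (§1 under the integral sign, then the head).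
[cite: Bump1997, §1.6, §3.7] [cite: MoeglinWaldspurger1995, I.2.10] -/
theorem integral_integral_archSymbolU3_mul_phase_eq {dδ : ℝ} (hδ : 0 < dδ) (ξ : ℂ) {z : ℂ} (hz : 1 < z.re) :
    ∫ X : ℂ, (∫ s : ℝ, ((((1 + ‖X‖ ^ 2 / 2) ^ 2 + dδ ^ 2 * s ^ 2 : ℝ)) : ℂ) ^ (-z)) * Complex.exp (-(4 * π * Complex.I * (ξ * X).re)) =
      2 * (π : ℂ) ^ 2 * (4 : ℂ) ^ (1 - z) * ((dδ : ℝ) : ℂ)⁻¹ * (Complex.Gamma z)⁻¹ ^ 2 *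
        mellin (fun t : ℝ => Complex.exp (-(t : ℂ) - ((8 * π ^ 2 * ‖ξ‖ ^ 2 : ℝ) : ℂ) / (t : ℂ))) (2 * z - 2) := by
  have hz' : 1 / 2 < z.re := by linarith
  simp_rw [integral_archCentreSymbol_eq hδ _ hz']
  exact integral_archWhittakerU3_eq dδ ξ hz

end Summit.HodgeConjecture.HodgeConjecture.Cruxes.H413.K2E1ArchWhittakerContinuationU3

end
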